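import Summits.BirchSwinnertonDyer.Rank1Residual.X11b.AnticyclotomicControlCount
import Summits.BirchSwinnertonDyer.Rank1Residual.X11b.AnticyclotomicControlLocallyTrivial
import Summits.BirchSwinnertonDyer.Rank1Residual.X11b.LocalKernelTamagawaExact
import Summits.BirchSwinnertonDyer.Rank1Residual.X11b.BDPRouteLocalKernelBound
import Literature.NumberTheory.EllipticCurves.HeegnerPointsKolyvaginProofs
import Literature.NumberTheory.EllipticCurves.HeegnerPointsImaginaryQuadraticProofs
import Literature.NumberTheory.EllipticCurves.IwasawaAlgebraRankOneIdealProofs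
import Literature.NumberTheory.EllipticCurves.IwasawaAlgebraPseudoNullProofs
import Literature.NumberTheory.GaloisRepresentations.PadicAlgebraDegreeOnePlace
import Literature.NumberTheory.EllipticCurves.LocalTorsionGoodReductionProofs
import Literature.NumberTheory.EllipticCurves.TamagawaSubgroupProofs
import Literature.NumberTheory.EllipticCurves.NonEisensteinPrimeOfSurjective
import Summits.BirchSwinnertonDyer.Rank1Residual.X11b.CastellaErratumVersionOfRecord
import Summits.BirchSwinnertonDyer.Rank1Residual.X11b.BDPRouteSelmerCountExactPrimary
import Summits.BirchSwinnertonDyer.Rank1Residual.X11b.AnticyclotomicLocalTorsionDescent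
import Literature.NumberTheory.EllipticCurves.AnomalousOfRationalTorsionProofs
import HarnessLib

/-!
# Route `UniversalToricDescent`, children `TwinSplitIMCAtThreeGoodSS` (item stmt-BirchSwinnertonDyer-20695) and
# `TwinSplitIMCAtThreeMult` (20694), tier U: VANISHING CONTROL — `Sel_𝔭^Σ(K, E[p^∞]) = 0` + local descent ⟹
# `Ch_Λ(X_ac^Σ) = Λ` (generic: any totally complex `K`, any `E/K`, any `p`, any `ℤ_p`-extension)

Mathematics and Lean text: planner `bsd-wall-utd-idea` g4 (`HOME/bsd-wall/bsd-wall-utd-idea/Sketch-utd-idea-g4.lean`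
sha16 d3f248362826f0d9, §1–§2b VERBATIM; card `Ideas/idea-unit-pair-vanishing-control.md`, LENS-MEMO-UTD-IDEA-v6).
Landed by prover seat `bsd-wall-utd-p2` g3 (TURNKEY-3 of utd-idea g4's 18:16Z line; planners cannot write under
Theorems). Companion of the seat's unit-tier files `…MultValueRoute` (p553371) / `…MultUnitTierFlat` (p554486) /
`…GoodSSUnitTier`: there the Selmer side at a unit pair is read off JSW 2017 Thm. 3.3.1 (control with the count);
here it is CONTROL-FREE — surjectivity of the control map + a trivial base Selmer group, no `Module.Finite`, no
Euler-characteristic count, no named fact at all in this file.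

* §1 Nakayama for a locally nilpotent endomorphism: `ker ψ = 0 ⟹ S = 0` (`eq_zero_of_isLocNil_of_ker_trivial`).
* §2 on the tree objects (`X11b.AcSelmer`): `Sel^γ = 0 ⟹ Sel = 0 ⟹ X_ac = 0 ⟹ Ch_Λ(X_ac) = ⊤ ⟹
  XAc.HasCharValuationAt … 0`; control form `hasCharValuationAt_zero_of_controlMap_surjective_of_base_eq_bot`;
  local-descent form `hasCharValuationAt_zero_of_local_descent` (X11b's `controlMap_surjective_of_local_descent`).
* §2b the numeric atoms: `localKer_eq_bot_of_not_dvd_localTamagawaNumber` (`p ∤ c_v`), `localKer_eq_bot_of_decomp_le`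
  (places split completely in `K_∞`), `localKer_eq_bot_of_not_dvd_tamagawaProduct`, `localDescent_of_atoms`,
  `hasCharValuationAt_zero_of_atoms` (`E(K_𝔭)[p] = 0`, `ker r_v = 0` for `v ∤ p`, `Sel_𝔭(K, E[p^∞]) = 0`).

The twin instances (bucket C good-ss / bucket B multiplicative at `p = 3`, unit pairs) are in
`…TwinSplitUnitPairSelmerHalf.lean`. Nothing booked; beyond-print BSD theorem: NO. `--supports stmt-BirchSwinnertonDyer-20695`.

References: [GreenbergLNM1716] §1, §3 (pp. 74–75, 85–90), §4 Lemma 4.2; [JetchevSkinnerWan2017] §3.3, Prop. 3.3.4;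
[BourbakiAC5to7] Ch. VII §4 no. 5; [SilvermanAEC2009] Cor. VII.6.2.
-/

set_option linter.dupNamespace false
set_option autoImplicit false

noncomputable section

open scoped Classical

open NumberField IsDedekindDomain Field
open Literature.NumberTheory.EllipticCurves Literature.NumberTheory.EllipticCurves.GreenbergSelmer
open Literature.NumberTheory.GaloisRepresentations

namespace Summit.BirchSwinnertonDyer.BirchSwinnertonDyer.Theorems.UniversalToricDescentTwinSplit.VanishingControl

/-! ## §1 Nakayama for a locally nilpotent endomorphism (generic, PROVED) -/

section Nakayama

variable {S : Type*} [AddCommGroup S] {p : ℕ} {ψ : AddMonoid.End S}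

/-- If `ψ` is locally nilpotent on `S` and `ker ψ = 0`, then every element of `S` is `0`
(induction on the nilpotency exponent: `ψ^{N+1} s = 0 ⟹ ψ^N (ψ s) = 0 ⟹ ψ s = 0 ⟹ s = 0`).
Greenberg's "a discrete Λ-module with trivial Γ-invariants is zero". [folklore] -/
theorem eq_zero_of_isLocNil_of_ker_trivial (h : IwasawaDual.IsLocNil p ψ)
    (hker : ∀ s : S, ψ s = 0 → s = 0) (s : S) : s = 0 := by
  obtain ⟨N, hN⟩ := h.nil s
  induction N generalizing s with
  | zero => simpa using hN
  | succ N ih =>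
    have h1 : (ψ ^ N) (ψ s) = 0 := by
      rw [pow_succ, AddMonoid.End.coe_mul, Function.comp_apply] at hN
      exact hN
    exact hker s (ih (ψ s) h1)

/-- … hence `S` is a subsingleton. [folklore] -/
theorem subsingleton_of_isLocNil_of_ker_trivial (h : IwasawaDual.IsLocNil p ψ)
    (hker : ∀ s : S, ψ s = 0 → s = 0) : Subsingleton S :=
  ⟨fun a b => by
    rw [eq_zero_of_isLocNil_of_ker_trivial h hker a, eq_zero_of_isLocNil_of_ker_trivial h hker b]⟩

/-- The same with the hypothesis phrased as `endInvariants ψ = ⊥`. [folklore] -/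
theorem subsingleton_of_isLocNil_of_endInvariants_eq_bot (h : IwasawaDual.IsLocNil p ψ)
    (hinv : IwasawaDual.endInvariants ψ = ⊥) : Subsingleton S :=
  subsingleton_of_isLocNil_of_ker_trivial h fun s hs => by
    have hs' : s ∈ IwasawaDual.endInvariants ψ := (IwasawaDual.mem_endInvariants_iff ψ s).mpr hs
    rw [hinv] at hs'
    exact hs'

end Nakayama

/-! ## §2 On the tree objects: `Sel^γ = 0 ⟹ Ch_Λ(X_ac) = Λ` (PROVED) -/

section Tree

open Summit.BirchSwinnertonDyer.Rank1Residual.X11b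
open Summit.BirchSwinnertonDyer.Rank1Residual.X11b.AcSelmer

variable {K : Type} [Field K] [NumberField K] (E : WeierstrassCurve K) (p : ℕ) [Fact p.Prime]
  (κ : ZpExtension K p) (𝔭 : HeightOneSpectrum (𝓞 K)) (S : Set (HeightOneSpectrum (𝓞 K)))
  (γ : absoluteGaloisGroup K) [hγ : Fact (κ.IsTopGenerator γ)]

/-- `H⁰(Γ, Sel_𝔭^Σ(K_∞, E[p^∞])) = 0 ⟹ Sel_𝔭^Σ(K_∞, E[p^∞]) = 0` (Nakayama with the tree's
`isLocNil_conjSelmerAc_sub_one`). [cite: GreenbergLNM1716, §1 (after Conj. 1.3)] -/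
theorem subsingleton_selmerAc_of_endInvariants_eq_bot
    (hinv : IwasawaDual.endInvariants (conjSelmerAc E p κ 𝔭 S γ - 1) = ⊥) :
    Subsingleton (selmerAc E p κ 𝔭 S) :=
  subsingleton_of_isLocNil_of_endInvariants_eq_bot (isLocNil_conjSelmerAc_sub_one E p κ 𝔭 S hγ.out)
    hinv

/-- `Sel = 0 ⟹ X_ac^Σ = Hom(Sel, ℚ/ℤ) = 0`. [folklore] -/
theorem subsingleton_XAc [Subsingleton (selmerAc E p κ 𝔭 S)] : Subsingleton (XAc E p κ 𝔭 S γ) := by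
  unfold XAc
  exact ⟨fun x y => AddMonoidHom.ext fun s => by rw [Subsingleton.elim s 0, map_zero, map_zero]⟩

/-- `Sel = 0 ⟹ Ch_Λ(X_ac^Σ) = Λ` (a zero module is pseudo-null; pseudo-null modules have
characteristic ideal `1`). [cite: BourbakiAC5to7, Ch. VII §4 no. 5] -/
theorem charIdeal_eq_top_of_subsingleton [Subsingleton (selmerAc E p κ 𝔭 S)] :
    XAc.charIdeal E p κ 𝔭 S γ = ⊤ := by
  haveI := subsingleton_XAc E p κ 𝔭 S γ
  unfold XAc.charIdeal
  exact Module.charIdeal_eq_top_of_isPseudoNull (Module.isPseudoNull_of_subsingleton _ _)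

/-- `Sel = 0 ⟹ "ord_p f_ac^Σ(0) = 0"` in the route's currency `XAc.HasCharValuationAt … 0`
(torsion: trivially; generator `f = 1`). [cite: Castella2018, Thm. 2.3 (arXiv:1704.06608 p. 5) (shape only)] -/
theorem hasCharValuationAt_zero_of_subsingleton [Subsingleton (selmerAc E p κ 𝔭 S)] :
    XAc.HasCharValuationAt E p κ 𝔭 S γ 0 := by
  haveI := subsingleton_XAc E p κ 𝔭 S γ
  refine ⟨fun x => ⟨1, Subsingleton.elim _ _⟩, 1, ?_, ?_, ?_⟩
  · rw [charIdeal_eq_top_of_subsingleton, Ideal.span_singleton_one]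
  · simp
  · simp

/-- **Vanishing control, abstract form.** If the control map
`s : Sel_𝔭^Σ(K, E[p^∞]) → Sel_𝔭^Σ(K_∞, E[p^∞])^γ` is SURJECTIVE and Castella's Selmer group over `K`
is trivial, then `Ch_Λ(X_ac^Σ) = Λ`, valuation `0`. [cite: GreenbergLNM1716, §3 p. 90 and §4 Lemma 4.2] -/
theorem hasCharValuationAt_zero_of_controlMap_surjective_of_base_eq_bot
    (hsurj : Function.Surjective (controlMap E p κ 𝔭 S γ)) (hbase : selmerAcBase E p 𝔭 S = ⊥) :
    XAc.HasCharValuationAt E p κ 𝔭 S γ 0 := by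
  have hinv : IwasawaDual.endInvariants (conjSelmerAc E p κ 𝔭 S γ - 1) = ⊥ := by
    rw [eq_bot_iff]
    intro x hx
    obtain ⟨c, hc⟩ := hsurj ⟨x, hx⟩
    have hc0 : c = 0 := by
      have hmem : (c : E.subgroupH1 p (⊤ : Subgroup (absoluteGaloisGroup K))) ∈
          (⊥ : AddSubgroup (E.subgroupH1 p (⊤ : Subgroup (absoluteGaloisGroup K)))) :=
        hbase ▸ c.2
      rw [AddSubgroup.mem_bot] at hmem
      exact Subtype.ext hmem
    rw [hc0, map_zero] at hc
    rw [AddSubgroup.mem_bot]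
    exact congrArg Subtype.val hc.symm
  haveI := subsingleton_selmerAc_of_endInvariants_eq_bot E p κ 𝔭 S γ hinv
  exact hasCharValuationAt_zero_of_subsingleton E p κ 𝔭 S γ

/-- **Vanishing control modulo local descent** (totally complex `K`, any `E/K`, any `p`, any
`ℤ_p`-extension with topological generator `γ`): local torsion-freeness above `𝔭` along the tower,
away descent at the finite places `∉ Σ ∪ {w ∣ p}`, and `Sel_𝔭^Σ(K, E[p^∞]) = 0` give
`Ch_Λ(X_ac^Σ) = Λ`. Injectivity of restriction (`E(K_∞)[p^∞] = 0`) is NOT needed for vanishing.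
[cite: GreenbergLNM1716, §3 p. 90] [cite: JetchevSkinnerWan2017, §3.3 (control; shape only)] -/
theorem hasCharValuationAt_zero_of_local_descent [IsTotallyComplex K] [E.IsElliptic]
    (h0 : FixedPoints.addSubgroup ↥(decomp 𝔭 ⊓ κ.kerSubgroup) (E.geomPrimaryTorsion p) = ⊥)
    (hS : ∀ c : E.subgroupH1 p (⊤ : Subgroup (absoluteGaloisGroup K)),
      E.resOfLe p (le_top : κ.kerSubgroup ≤ ⊤) c ∈ selmerAc E p κ 𝔭 S →
        ∀ v : HeightOneSpectrum (𝓞 K), ((p : ℕ) : 𝓞 K) ∉ v.asIdeal → v ∉ S →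
          c ∈ awayKer ⊤ (E.geomPrimaryTorsion p) v)
    (hbase : selmerAcBase E p 𝔭 S = ⊥) :
    XAc.HasCharValuationAt E p κ 𝔭 S γ 0 :=
  hasCharValuationAt_zero_of_controlMap_surjective_of_base_eq_bot E p κ 𝔭 S γ
    (controlMap_surjective_of_local_descent p κ E 𝔭 S hγ.out h0 hS
      (fun c hc w ↦ infConditions_descend_of_isTotallyComplex E p κ 𝔭 S c hc w)) hbase

/-! ### §2b The two local atoms (PROVED reductions to numeric inputs) -/

/-- **Local kernel at `v ∤ p` from the Tamagawa count**: if `v` does not split completely in `K_∞`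
and `p ∤ c_v(E/K)`, then `ker r_v = 0` (the tree's exact count `#ker r_v = p^{ord_p c_v}`).
[cite: GreenbergLNM1716, §3 Lemma 3.3 (p. 87)] [cite: JetchevSkinnerWan2017, Prop. 3.3.4] -/
theorem localKer_eq_bot_of_not_dvd_localTamagawaNumber [E.IsElliptic] {v : HeightOneSpectrum (𝓞 K)}
    (hpv : ((p : ℕ) : 𝓞 K) ∉ v.asIdeal) (hv : ¬ decomp v ≤ κ.kerSubgroup)
    (hc : ¬ p ∣ (E.baseChange (v.adicCompletion K)).localTamagawaNumber (v.adicCompletionIntegers K)) :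
    localKer κ.kerSubgroup (E.geomPrimaryTorsion p) v = ⊥ := by
  obtain ⟨hfin, hcard⟩ := natCard_localKer_eq_pow_padicValNat_localTamagawaNumber E κ hpv hv
  haveI := hfin
  rw [padicValNat.eq_zero_of_not_dvd hc, pow_zero] at hcard
  exact AddSubgroup.eq_bot_of_card_eq _ hcard

omit [Fact p.Prime] in
/-- **Local kernel at a place that splits completely in `K_∞`** (`D_v ≤ ker κ`, e.g. a prime of
`K` inert over `ℚ` in the anticyclotomic tower): `K_{∞,η} = K_v`, so `ker r_v = 0` — restriction
along `ker κ ⊓ D_v = ⊤ ⊓ D_v` is the identity (`resOfLe_comp_holds`, `resOfLe_refl_holds`).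
[cite: GreenbergLNM1716, §3 p. 85] -/
theorem localKer_eq_bot_of_decomp_le {H : Subgroup (absoluteGaloisGroup K)}
    {v : HeightOneSpectrum (𝓞 K)} (hD : decomp v ≤ H) :
    localKer H (E.geomPrimaryTorsion p) v = ⊥ := by
  have hBA : (⊤ : Subgroup (absoluteGaloisGroup K)) ⊓ decomp v ≤ H ⊓ decomp v :=
    le_inf (inf_le_right.trans hD) inf_le_right
  have hAB : H ⊓ decomp v ≤ (⊤ : Subgroup (absoluteGaloisGroup K)) ⊓ decomp v :=
    inf_le_inf_right (decomp v) le_top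
  have hid : (resOfLe (E.geomPrimaryTorsion p) hBA).comp (resOfLe (E.geomPrimaryTorsion p) hAB) =
      AddMonoidHom.id _ := by
    rw [resOfLe_comp_holds hBA hAB]
    exact resOfLe_refl_holds _
  rw [localKer, eq_bot_iff]
  intro c hc
  rw [AddMonoidHom.mem_ker] at hc
  rw [AddSubgroup.mem_bot, ← AddMonoidHom.id_apply _ c, ← hid, AddMonoidHom.comp_apply, hc, map_zero]

omit [Fact p.Prime] in
/-- **Each local Tamagawa number divides the Tamagawa product** (the `finprod` is a finite product
over the bad places, `mulSupport_localTamagawaNumber_finite_holds`). [cite: SilvermanAEC2009, Cor. VII.6.2] -/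
theorem localTamagawaNumber_dvd_tamagawaProduct [E.IsElliptic] (v : HeightOneSpectrum (𝓞 K)) :
    (E.baseChange (v.adicCompletion K)).localTamagawaNumber (v.adicCompletionIntegers K) ∣
      E.tamagawaProduct := by
  have hfin : (Function.mulSupport fun w : HeightOneSpectrum (𝓞 K) =>
      (E.baseChange (w.adicCompletion K)).localTamagawaNumber (w.adicCompletionIntegers K)).Finite :=
    E.mulSupport_localTamagawaNumber_finite_holds
  have hsub : (Function.mulSupport fun w : HeightOneSpectrum (𝓞 K) =>
      (E.baseChange (w.adicCompletion K)).localTamagawaNumber (w.adicCompletionIntegers K)) ⊆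
      ↑(insert v hfin.toFinset) := fun w hw ↦ by
    rw [Finset.coe_insert, Set.Finite.coe_toFinset]
    exact Set.mem_insert_of_mem _ hw
  rw [WeierstrassCurve.tamagawaProduct, finprod_eq_prod_of_mulSupport_subset _ hsub]
  exact Finset.dvd_prod_of_mem _ (Finset.mem_insert_self v _)

/-- **`ker r_v = 0` at every finite `v ∤ p` as soon as `p ∤ ∏_w c_w(E/K)`** (split-completely
places: `localKer_eq_bot_of_decomp_le`; the others: the Tamagawa count). -/
theorem localKer_eq_bot_of_not_dvd_tamagawaProduct [E.IsElliptic]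
    (hc : ¬ p ∣ E.tamagawaProduct) {v : HeightOneSpectrum (𝓞 K)}
    (hpv : ((p : ℕ) : 𝓞 K) ∉ v.asIdeal) :
    localKer κ.kerSubgroup (E.geomPrimaryTorsion p) v = ⊥ := by
  by_cases hD : decomp v ≤ κ.kerSubgroup
  · exact localKer_eq_bot_of_decomp_le E p hD
  · exact localKer_eq_bot_of_not_dvd_localTamagawaNumber E p κ hpv hD
      fun h ↦ hc (h.trans (localTamagawaNumber_dvd_tamagawaProduct E v))

/-- **Local descent from the two atoms** (`Σ = ∅`): `E(K_𝔭)[p] = 0` gives the torsion-freeness above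
`𝔭` along the tower, and `ker r_v = 0` at every finite `v ∤ p` gives the away descent.
[cite: GreenbergLNM1716, §3 pp. 74–75, 87, 90] -/
theorem localDescent_of_atoms [E.IsElliptic]
    (h𝔭 : ∀ R : (E.baseChange (𝔭.adicCompletion K)).toAffine.Point, p • R = 0 → R = 0)
    (hker : ∀ v : HeightOneSpectrum (𝓞 K), ((p : ℕ) : 𝓞 K) ∉ v.asIdeal →
      localKer κ.kerSubgroup (E.geomPrimaryTorsion p) v = ⊥) :
    FixedPoints.addSubgroup ↥(decomp 𝔭 ⊓ κ.kerSubgroup) (E.geomPrimaryTorsion p) = ⊥ ∧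
      ∀ c : E.subgroupH1 p (⊤ : Subgroup (absoluteGaloisGroup K)),
        E.resOfLe p (le_top : κ.kerSubgroup ≤ ⊤) c ∈ selmerAc E p κ 𝔭 ∅ →
          ∀ v : HeightOneSpectrum (𝓞 K), ((p : ℕ) : 𝓞 K) ∉ v.asIdeal → v ∉ (∅ : Set _) →
            c ∈ awayKer ⊤ (E.geomPrimaryTorsion p) v :=
  ⟨fixedPoints_decomp_inf_kerSubgroup_eq_bot κ E 𝔭 fun m hfix hpm ↦
      eq_zero_of_fixed_decomp_of_local E p 𝔭 h𝔭 m hfix hpm,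
    fun _ hc v hv hvS ↦ mem_awayKer_of_localKer_eq_bot hv hvS (hker v hv) hc⟩

/-- **Vanishing control from three numeric atoms** (totally complex `K`, `Σ = ∅`):
`E(K_𝔭)[p] = 0`, `ker r_v = 0` for all finite `v ∤ p`, and `Sel_𝔭(K, E[p^∞]) = 0` ⟹ `Ch_Λ(X_ac) = Λ`.
This is the form the twin line instantiates (T1 = first two atoms, T2 = third). -/
theorem hasCharValuationAt_zero_of_atoms [IsTotallyComplex K] [E.IsElliptic]
    (h𝔭 : ∀ R : (E.baseChange (𝔭.adicCompletion K)).toAffine.Point, p • R = 0 → R = 0)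
    (hker : ∀ v : HeightOneSpectrum (𝓞 K), ((p : ℕ) : 𝓞 K) ∉ v.asIdeal →
      localKer κ.kerSubgroup (E.geomPrimaryTorsion p) v = ⊥)
    (hbase : selmerAcBase E p 𝔭 ∅ = ⊥) :
    XAc.HasCharValuationAt E p κ 𝔭 ∅ γ 0 := by
  obtain ⟨h0, hS⟩ := localDescent_of_atoms E p κ 𝔭 h𝔭 hker
  exact hasCharValuationAt_zero_of_local_descent E p κ 𝔭 ∅ γ h0 hS hbase

end Tree

end Summit.BirchSwinnertonDyer.BirchSwinnertonDyer.Theorems.UniversalToricDescentTwinSplit.VanishingControl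

end
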